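import Mathlib

/-!
# Submultiplicativity of the weighted `ℓ¹` size of multivariable power series

Stub `stub_mvWeightedNormMul` (S1) for the crux `HilbertIntegralOverconvergentIsCongruence`
(line Sketch-ideate-r1-k1): for an additive weight `wt : (σ →₀ ℕ) →+ ℕ` and `t ≥ 0`, the weighted
size `W_t(φ) = ∑_ν ‖coeff ν φ‖ t ^ (wt ν)` of a complex multivariable power series satisfies
`W_t(φ ψ) ≤ W_t(φ) W_t(ψ)` (with summability), via `MvPowerSeries.coeff_mul` and the Cauchy
product of nonnegative real families indexed by the `HasAntidiagonal` monoid `σ →₀ ℕ`.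
This is the `σ →₀ ℕ` analogue of the one-variable `stub_weightedNormMul`.
-/

set_option linter.dupNamespace false

noncomputable section

namespace Summit.Langlands.Langlands.Theorems.HilbertIntegralOverconvergentIsCongruence

/-- Submultiplicativity of the weighted `ℓ¹` size `W_t(φ) = ∑_ν ‖φ_ν‖ t ^ (wt ν)` (`t ≥ 0`,
`wt : (σ →₀ ℕ) →+ ℕ` an additive weight) of complex multivariable power series: if `W_t(φ)` and
`W_t(ψ)` converge then so does `W_t(φ ψ)`, and `W_t(φ ψ) ≤ W_t(φ) W_t(ψ)`. Proof:
`coeff ν (φ ψ) = ∑_{ν₁+ν₂=ν} φ_{ν₁} ψ_{ν₂}` (sum over `Finset.antidiagonal ν`) and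
`t ^ wt (ν₁ + ν₂) = t ^ wt ν₁ * t ^ wt ν₂` by additivity of `wt`, so
`‖coeff ν (φ ψ)‖ t ^ (wt ν) ≤ ∑_{ν₁+ν₂=ν} (‖φ_{ν₁}‖ t ^ (wt ν₁)) (‖ψ_{ν₂}‖ t ^ (wt ν₂))`, whose
right-hand side is the `ν`-th term of the Cauchy product of two summable nonnegative real families
(`summable_sum_mul_antidiagonal_of_summable_mul`,
`Summable.tsum_mul_tsum_eq_tsum_sum_antidiagonal`). Port of the one-variable
`stub_weightedNormMul`. -/
theorem stub_mvWeightedNormMul {σ : Type*} (wt : (σ →₀ ℕ) →+ ℕ) (φ ψ : MvPowerSeries σ ℂ) (t : ℝ)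
    (ht : 0 ≤ t)
    (hφ : Summable fun n : σ →₀ ℕ ↦ ‖MvPowerSeries.coeff n φ‖ * t ^ wt n)
    (hψ : Summable fun n : σ →₀ ℕ ↦ ‖MvPowerSeries.coeff n ψ‖ * t ^ wt n) :
    Summable (fun n : σ →₀ ℕ ↦ ‖MvPowerSeries.coeff n (φ * ψ)‖ * t ^ wt n) ∧
      ∑' n : σ →₀ ℕ, ‖MvPowerSeries.coeff n (φ * ψ)‖ * t ^ wt n ≤
        (∑' n : σ →₀ ℕ, ‖MvPowerSeries.coeff n φ‖ * t ^ wt n) *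
          ∑' n : σ →₀ ℕ, ‖MvPowerSeries.coeff n ψ‖ * t ^ wt n := by
  classical
  set a : (σ →₀ ℕ) → ℝ := fun n ↦ ‖MvPowerSeries.coeff n φ‖ * t ^ wt n with ha_def
  set b : (σ →₀ ℕ) → ℝ := fun n ↦ ‖MvPowerSeries.coeff n ψ‖ * t ^ wt n with hb_def
  have ha : 0 ≤ a := fun n ↦ mul_nonneg (norm_nonneg _) (pow_nonneg ht _)
  have hb : 0 ≤ b := fun n ↦ mul_nonneg (norm_nonneg _) (pow_nonneg ht _)
  -- the Cauchy product of the two nonnegative summable real families `a`, `b`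
  have hab : Summable fun x : (σ →₀ ℕ) × (σ →₀ ℕ) ↦ a x.1 * b x.2 := hφ.mul_of_nonneg hψ ha hb
  have hsum : Summable fun n : σ →₀ ℕ ↦
      ∑ kl ∈ Finset.HasAntidiagonal.antidiagonal n, a kl.1 * b kl.2 :=
    summable_sum_mul_antidiagonal_of_summable_mul hab
  have heq : (∑' n, a n) * ∑' n, b n =
      ∑' n, ∑ kl ∈ Finset.HasAntidiagonal.antidiagonal n, a kl.1 * b kl.2 :=
    hφ.tsum_mul_tsum_eq_tsum_sum_antidiagonal hψ hab
  -- termwise comparison with the Cauchy product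
  have hle : ∀ n : σ →₀ ℕ, ‖MvPowerSeries.coeff n (φ * ψ)‖ * t ^ wt n ≤
      ∑ kl ∈ Finset.HasAntidiagonal.antidiagonal n, a kl.1 * b kl.2 := by
    intro n
    rw [MvPowerSeries.coeff_mul]
    calc ‖∑ p ∈ Finset.HasAntidiagonal.antidiagonal n,
            MvPowerSeries.coeff p.1 φ * MvPowerSeries.coeff p.2 ψ‖ * t ^ wt n
        ≤ (∑ p ∈ Finset.HasAntidiagonal.antidiagonal n,
            ‖MvPowerSeries.coeff p.1 φ * MvPowerSeries.coeff p.2 ψ‖) * t ^ wt n :=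
          mul_le_mul_of_nonneg_right (norm_sum_le _ _) (pow_nonneg ht _)
      _ = ∑ kl ∈ Finset.HasAntidiagonal.antidiagonal n, a kl.1 * b kl.2 := by
          rw [Finset.sum_mul]
          refine Finset.sum_congr rfl fun p hp ↦ ?_
          rw [Finset.HasAntidiagonal.mem_antidiagonal] at hp
          rw [norm_mul, ha_def, hb_def, ← hp, map_add, pow_add]
          ring
  have hnn : ∀ n : σ →₀ ℕ, 0 ≤ ‖MvPowerSeries.coeff n (φ * ψ)‖ * t ^ wt n := fun n ↦
    mul_nonneg (norm_nonneg _) (pow_nonneg ht _)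
  have hS : Summable fun n : σ →₀ ℕ ↦ ‖MvPowerSeries.coeff n (φ * ψ)‖ * t ^ wt n :=
    hsum.of_nonneg_of_le hnn hle
  refine ⟨hS, ?_⟩
  rw [heq]
  exact hS.tsum_le_tsum hle hsum

end Summit.Langlands.Langlands.Theorems.HilbertIntegralOverconvergentIsCongruence

end
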